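import Summits.Ventures.PercRepro.C041ZoneZSkelDefs

/-!
# The dictionary between the skeleton and its zone with forced edges (p6, gen 27; C-041.md §13, THEOREM (INV) — part 2)

Setting of `C041ZoneZSkelDefs`: `F = skelZone a b O`, `σ = toState S` for a configuration `S`.  The abstract notions of
`C041ZoneZDefs` read on `σ` are the skeleton notions read on `S`:

* adjacency from a non-terminal: blue = `BlueBareAdj`, red = `BareAdj` (`skel_blueAdj_iff`, `skel_redAdj_iff`); the
  marks = a blue / red terminal edge at a non-terminal (`skel_mem_Bl_iff`, …); the reaches from non-terminals =
  `BlueBareConn` / red bare walks (`skel_mem_reach_blue_iff`, `skel_mem_reach_red_iff`);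
* `D` = the vertices whose sub-zone is attached to `a` (`skel_mem_D_iff`), `adm` = «no sub-zone attached to both
  terminals» (`skel_adm_iff`), `Γ` for `Q = {c}` = «the sub-zone of the probe is unattached» (`skel_gam_iff`), `Forced` =
  the cube conditions with the edges between the terminals red (`skel_forced_iff`) — so a CUBE STATE is exactly a
  forced admissible state with `Γ` (`skel_isCubeState_iff`);
* with the anchor set `K₀ = K(O)`: `K = K(S)` (`skel_K_eq`), «blue at `K`» = invalid (`skel_blueK_iff`), «no anchor
  deleted» gives `ρ_a(u)` for every `u ∈ K₀` (`skel_rhoA_of_not_anchorDel`), `¬ρ_a(u)` deletes an anchor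
  (`skel_anchorDel_of_not_rhoA`), and «no red `2`-edge at `REACH`» with no anchor deleted gives `¬Good_a`
  (`skel_not_goodA_of_reach2`) — the inclusions (L) and (R) of C-041.md §13.
-/

namespace PercRepro

namespace MultiGraph

open Finset ZoneZ ZoneZ.ZoneData

variable {V E : Type*} {G : MultiGraph V E} {a b : V}

section Adj

variable (O S : Config E)

/-- The joins of the skeleton zone are the joins of `G`. -/
theorem skel_joins_iff (e : G.EdgeN a b) (u v : V) : (G.skelZone a b O).Joins e u v ↔ G.Joins e.1 u v := Iff.rfl

/-- Blue adjacency from a non-terminal is blue bare adjacency. -/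
theorem skel_blueAdj_iff {u v : V} (hu : u ≠ a ∧ u ≠ b) :
    (G.skelZone a b O).BlueAdj (G.toState a b S) u v ↔ G.BlueBareAdj a b S u v := by
  constructor
  · rintro ⟨e, hj, hc⟩
    exact ⟨e.1, bare_of_edgeN e.2 hu hj, hc, hj⟩
  · rintro ⟨e, he, hc, hj⟩
    exact ⟨⟨e, not_termA_of_bare he, not_termB_of_bare he⟩, hj, hc⟩

/-- Red adjacency from a non-terminal is red bare adjacency. -/
theorem skel_redAdj_iff {u v : V} (hu : u ≠ a ∧ u ≠ b) :
    (G.skelZone a b O).RedAdj (G.toState a b S) u v ↔ G.BareAdj a b S u v := by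
  constructor
  · rintro ⟨e, hj, hc⟩
    exact ⟨e.1, bare_of_edgeN e.2 hu hj, hc, hj⟩
  · rintro ⟨e, he, hc, hj⟩
    exact ⟨⟨e, not_termA_of_bare he, not_termB_of_bare he⟩, hj, hc⟩

/-- The marks of side `a`: a terminal edge of colour `x` to `a` at a non-terminal. -/
theorem skel_mem_mark1_iff (x : Bool) (v : V) :
    v ∈ markSet (G.skelZone a b O).at₁ (G.toState a b S).2.1 x ↔
      (v ≠ a ∧ v ≠ b) ∧ ∃ e, G.Joins e v a ∧ S e = x := by
  constructor
  · rintro ⟨⟨e, v', hv'a, hv'b, hj⟩, ht, hm⟩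
    have : G.nonTermEnd a b e = v' := nonTermEnd_eq ⟨hv'a, hv'b⟩ (Or.inl rfl) hj
    change G.nonTermEnd a b e = v at ht
    rw [this] at ht
    subst ht
    exact ⟨⟨hv'a, hv'b⟩, e, hj, hm⟩
  · rintro ⟨hv, e, hj, hm⟩
    exact ⟨⟨e, v, hv.1, hv.2, hj⟩, nonTermEnd_eq hv (Or.inl rfl) hj, hm⟩

/-- The marks of side `b`: a terminal edge of colour `x` to `b` at a non-terminal. -/
theorem skel_mem_mark2_iff (x : Bool) (v : V) :
    v ∈ markSet (G.skelZone a b O).at₂ (G.toState a b S).2.2 x ↔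
      (v ≠ a ∧ v ≠ b) ∧ ∃ e, G.Joins e v b ∧ S e = x := by
  constructor
  · rintro ⟨⟨e, v', hv'a, hv'b, hj⟩, ht, hm⟩
    have : G.nonTermEnd a b e = v' := nonTermEnd_eq ⟨hv'a, hv'b⟩ (Or.inr rfl) hj
    change G.nonTermEnd a b e = v at ht
    rw [this] at ht
    subst ht
    exact ⟨⟨hv'a, hv'b⟩, e, hj, hm⟩
  · rintro ⟨hv, e, hj, hm⟩
    exact ⟨⟨e, v, hv.1, hv.2, hj⟩, nonTermEnd_eq hv (Or.inr rfl) hj, hm⟩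

/-- A blocker: a blue `a`-edge at a non-terminal. -/
theorem skel_mem_Bl_iff (v : V) :
    v ∈ (G.skelZone a b O).Bl (G.toState a b S) ↔ (v ≠ a ∧ v ≠ b) ∧ ∃ e, G.Joins e v a ∧ S e = false :=
  skel_mem_mark1_iff O S false v

/-- A red `1`-mark: a red `a`-edge at a non-terminal. -/
theorem skel_mem_Blt_iff (v : V) :
    v ∈ (G.skelZone a b O).Blt (G.toState a b S) ↔ (v ≠ a ∧ v ≠ b) ∧ ∃ e, G.Joins e v a ∧ S e = true :=
  skel_mem_mark1_iff O S true v

/-- A blue `2`-mark: a blue `b`-edge at a non-terminal. -/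
theorem skel_mem_M_iff (v : V) :
    v ∈ (G.skelZone a b O).M (G.toState a b S) ↔ (v ≠ a ∧ v ≠ b) ∧ ∃ e, G.Joins e v b ∧ S e = false :=
  skel_mem_mark2_iff O S false v

/-- A red `2`-mark: a red `b`-edge at a non-terminal. -/
theorem skel_mem_Mt_iff (v : V) :
    v ∈ (G.skelZone a b O).Mt (G.toState a b S) ↔ (v ≠ a ∧ v ≠ b) ∧ ∃ e, G.Joins e v b ∧ S e = true :=
  skel_mem_mark2_iff O S true v

/-- The blue reach of a set of non-terminals is blue bare connectivity. -/
theorem skel_mem_reach_blue_iff {S' : Set V} (hS' : ∀ s ∈ S', s ≠ a ∧ s ≠ b) (v : V) :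
    v ∈ reach ((G.skelZone a b O).BlueAdj (G.toState a b S)) S' ↔ ∃ s ∈ S', G.BlueBareConn a b S s v := by
  constructor
  · rintro ⟨s, hs, h⟩
    refine ⟨s, hs, ?_⟩
    induction h with
    | refl => exact BlueBareConn.refl a b S s
    | tail _ hxy ih =>
      exact ih.tail ((skel_blueAdj_iff O S (ne_terminal_of_blueBareConn ih (hS' s hs))).1 hxy)
  · rintro ⟨s, hs, h⟩
    refine ⟨s, hs, ?_⟩
    induction h with
    | refl => exact Relation.ReflTransGen.refl
    | tail hpre hxy ih =>
      exact ih.tail ((skel_blueAdj_iff O S (ne_terminal_of_blueBareConn hpre (hS' s hs))).2 hxy)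

/-- The red reach of a set of non-terminals is red bare connectivity. -/
theorem skel_mem_reach_red_iff {S' : Set V} (hS' : ∀ s ∈ S', s ≠ a ∧ s ≠ b) (v : V) :
    v ∈ reach ((G.skelZone a b O).RedAdj (G.toState a b S)) S' ↔
      ∃ s ∈ S', Relation.ReflTransGen (G.BareAdj a b S) s v := by
  constructor
  · rintro ⟨s, hs, h⟩
    refine ⟨s, hs, ?_⟩
    induction h with
    | refl => exact Relation.ReflTransGen.refl
    | tail _ hxy ih =>
      exact ih.tail ((skel_redAdj_iff O S (ne_terminal_of_bareReach ih (hS' s hs))).1 hxy)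
  · rintro ⟨s, hs, h⟩
    refine ⟨s, hs, ?_⟩
    induction h with
    | refl => exact Relation.ReflTransGen.refl
    | tail hpre hxy ih =>
      exact ih.tail ((skel_redAdj_iff O S (ne_terminal_of_bareReach hpre (hS' s hs))).2 hxy)

end Adj

section Sets

variable (O S : Config E)

/-- The deleted vertices are the non-terminals whose sub-zone is attached to `a`. -/
theorem skel_mem_D_iff {v : V} (hv : v ≠ a ∧ v ≠ b) :
    v ∈ (G.skelZone a b O).D (G.toState a b S) ↔ G.Attached a b S v a := by
  unfold ZoneData.D
  rw [skel_mem_reach_blue_iff O S (fun s hs => ((skel_mem_Bl_iff O S s).1 hs).1)]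
  constructor
  · rintro ⟨w, hw, hwv⟩
    obtain ⟨_, e, hj, hSe⟩ := (skel_mem_Bl_iff O S w).1 hw
    exact ⟨w, hwv.symm, e, hSe, hj⟩
  · rintro ⟨w, hvw, e, hSe, hj⟩
    exact ⟨w, (skel_mem_Bl_iff O S w).2 ⟨ne_terminal_of_blueBareConn hvw hv, e, hj, hSe⟩, hvw.symm⟩

/-- The blue reach of the `2`-blockers: the non-terminals whose sub-zone is attached to `b`. -/
theorem skel_mem_reach_M_iff {v : V} (hv : v ≠ a ∧ v ≠ b) :
    v ∈ reach ((G.skelZone a b O).BlueAdj (G.toState a b S)) ((G.skelZone a b O).M (G.toState a b S)) ↔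
      G.Attached a b S v b := by
  rw [skel_mem_reach_blue_iff O S (fun s hs => ((skel_mem_M_iff O S s).1 hs).1)]
  constructor
  · rintro ⟨w, hw, hwv⟩
    obtain ⟨_, e, hj, hSe⟩ := (skel_mem_M_iff O S w).1 hw
    exact ⟨w, hwv.symm, e, hSe, hj⟩
  · rintro ⟨w, hvw, e, hSe, hj⟩
    exact ⟨w, (skel_mem_M_iff O S w).2 ⟨ne_terminal_of_blueBareConn hvw hv, e, hj, hSe⟩, hvw.symm⟩

/-- Admissibility: no sub-zone is attached to both terminals. -/
theorem skel_adm_iff :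
    (G.skelZone a b O).adm (G.toState a b S) ↔
      ∀ v, v ≠ a → v ≠ b → ¬ (G.Attached a b S v a ∧ G.Attached a b S v b) := by
  unfold ZoneData.adm
  constructor
  · intro h v hva hvb ⟨ha, hb⟩
    obtain ⟨w, hvw, e, hSe, hj⟩ := hb
    have hw : w ≠ a ∧ w ≠ b := ne_terminal_of_blueBareConn hvw ⟨hva, hvb⟩
    have hwM : w ∈ (G.skelZone a b O).M (G.toState a b S) := (skel_mem_M_iff O S w).2 ⟨hw, e, hj, hSe⟩
    have hwD : w ∈ (G.skelZone a b O).D (G.toState a b S) := by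
      rw [skel_mem_D_iff O S hw]
      exact attached_of_blueBareConn hvw.symm ha
    exact Set.disjoint_left.1 h hwM hwD
  · intro h
    rw [Set.disjoint_left]
    intro w hwM hwD
    obtain ⟨hw, e, hj, hSe⟩ := (skel_mem_M_iff O S w).1 hwM
    rw [skel_mem_D_iff O S hw] at hwD
    exact h w hw.1 hw.2 ⟨hwD, w, BlueBareConn.refl a b S w, e, hSe, hj⟩

/-- `Γ` for the protected anchor `c`: the sub-zone of the probe is attached to neither terminal. -/
theorem skel_gam_iff {c : V} (hc : c ≠ a ∧ c ≠ b) :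
    (G.skelZone a b O).Gam {c} (G.toState a b S) ↔ ¬ G.Attached a b S c a ∧ ¬ G.Attached a b S c b := by
  unfold ZoneData.Gam ZoneData.P
  have hreach := skel_mem_reach_blue_iff (G := G) O S (S' := {c}) (fun s hs => by
    rw [Set.mem_singleton_iff] at hs
    exact hs ▸ hc)
  constructor
  · intro h
    constructor
    · rintro ⟨w, hcw, e, hSe, hj⟩
      have hw := ne_terminal_of_blueBareConn hcw hc
      exact Set.disjoint_left.1 h ((hreach w).2 ⟨c, rfl, hcw⟩) (Or.inl ((skel_mem_Bl_iff O S w).2 ⟨hw, e, hj, hSe⟩))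
    · rintro ⟨w, hcw, e, hSe, hj⟩
      have hw := ne_terminal_of_blueBareConn hcw hc
      exact Set.disjoint_left.1 h ((hreach w).2 ⟨c, rfl, hcw⟩) (Or.inr ((skel_mem_M_iff O S w).2 ⟨hw, e, hj, hSe⟩))
  · rintro ⟨ha, hb⟩
    rw [Set.disjoint_left]
    intro w hw hw'
    obtain ⟨s, hs, hsw⟩ := (hreach w).1 hw
    rw [Set.mem_singleton_iff] at hs
    subst hs
    rcases hw' with hw' | hw'
    · obtain ⟨_, e, hj, hSe⟩ := (skel_mem_Bl_iff O S w).1 hw'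
      exact ha ⟨w, hsw, e, hSe, hj⟩
    · obtain ⟨_, e, hj, hSe⟩ := (skel_mem_M_iff O S w).1 hw'
      exact hb ⟨w, hsw, e, hSe, hj⟩

/-- An edge between the terminals is an edge of `EdgeN`. -/
theorem edgeN_of_joins_terminals {e : E} (he : G.Joins e a b) : ¬ G.TermA a b e ∧ ¬ G.TermB a b e := by
  constructor
  · rintro ⟨v, hva, hvb, hj⟩
    rcases he with ⟨h1, h2⟩ | ⟨h1, h2⟩ <;> rcases hj with ⟨h3, h4⟩ | ⟨h3, h4⟩
    · exact hva (h3.symm.trans h1)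
    · exact hvb (h4.symm.trans h2)
    · exact hvb (h3.symm.trans h1)
    · exact hva (h4.symm.trans h2)
  · rintro ⟨v, hva, hvb, hj⟩
    rcases he with ⟨h1, h2⟩ | ⟨h1, h2⟩ <;> rcases hj with ⟨h3, h4⟩ | ⟨h3, h4⟩
    · exact hva (h3.symm.trans h1)
    · exact hvb (h4.symm.trans h2)
    · exact hvb (h3.symm.trans h1)
    · exact hva (h4.symm.trans h2)

/-- The free edges of the skeleton zone. -/
theorem skel_free_iff (e : G.EdgeN a b) :
    (G.skelZone a b O).free e ↔ G.InteriorBlue a b O e.1 ∨ (¬ G.Bare a b e.1 ∧ ¬ G.Joins e.1 a b) := Iff.rfl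

open Classical in
/-- The forced colour of an edge of the skeleton zone. -/
theorem skel_fcol (e : G.EdgeN a b) : (G.skelZone a b O).fcol e = if G.Bare a b e.1 then O e.1 else true := rfl

open Classical in
/-- The forced colours: the two cube conditions on the bare edges and «the edges between the terminals are red». -/
theorem skel_forced_iff :
    (G.skelZone a b O).Forced (G.toState a b S) ↔
      (∀ e, G.Bare a b e → O e = true → S e = true) ∧
        (∀ e, G.Bare a b e → O e = false → S e = true → G.InteriorBlue a b O e) ∧
        (∀ e, G.Joins e a b → S e = true) := by
  unfold FZone.Forced
  constructor
  · intro h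
    refine ⟨fun e he hO => ?_, fun e he hO hS => ?_, fun e he => ?_⟩
    · have := h ⟨e, not_termA_of_bare he, not_termB_of_bare he⟩ (by
        rw [skel_free_iff]
        rintro (⟨_, hO', _⟩ | ⟨hb, _⟩)
        · rw [hO] at hO'
          exact absurd hO' (by decide)
        · exact hb he)
      change S e = (if G.Bare a b e then O e else true) at this
      rw [if_pos he] at this
      rw [this, hO]
    · by_contra hint
      have := h ⟨e, not_termA_of_bare he, not_termB_of_bare he⟩ (by
        rw [skel_free_iff]
        rintro (h' | ⟨hb, _⟩)
        · exact hint h'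
        · exact hb he)
      change S e = (if G.Bare a b e then O e else true) at this
      rw [if_pos he] at this
      rw [this, hO] at hS
      exact absurd hS (by decide)
    · have hb : ¬ G.Bare a b e := fun hb => hb.1 (EdgeAt.of_joins_left he)
      have := h ⟨e, (edgeN_of_joins_terminals he).1, (edgeN_of_joins_terminals he).2⟩ (by
        rw [skel_free_iff]
        rintro (⟨hb', _⟩ | ⟨_, hab⟩)
        · exact hb hb'
        · exact hab he)
      change S e = (if G.Bare a b e then O e else true) at this
      rw [if_neg hb] at this
      exact this
  · rintro ⟨h1, h2, h3⟩ ⟨e, he⟩ hfree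
    rw [skel_free_iff] at hfree
    change S e = (if G.Bare a b e then O e else true)
    rw [not_or, not_and_or, not_not] at hfree
    obtain ⟨hint, hbab⟩ := hfree
    by_cases hb : G.Bare a b e
    · rw [if_pos hb]
      cases hO : O e
      · cases hS : S e
        · rfl
        · exact absurd (h2 e hb hO hS) hint
      · exact h1 e hb hO
    · rw [if_neg hb]
      rcases hbab with hbab | hbab
      · exact absurd hbab hb
      · exact h3 e (not_not.1 hbab)

/-- **A cube state is a forced admissible state with `Γ`** (`isCubeState_iff` of `C041ZoneAdm` read on the zone). -/
theorem skel_isCubeState_iff [Fintype V] [Fintype E] [DecidableEq E] {c : V} (hc : c ≠ a ∧ c ≠ b) (hne : a ≠ b) :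
    G.IsCubeState a b c O S ↔
      (G.skelZone a b O).Forced (G.toState a b S) ∧ (G.skelZone a b O).adm (G.toState a b S) ∧
        (G.skelZone a b O).Gam {c} (G.toState a b S) := by
  rw [isCubeState_iff a b c hc hne, skel_forced_iff O S, skel_adm_iff O S, skel_gam_iff O S hc]
  constructor
  · rintro ⟨h1, h2, h3, h4, h5, h6⟩
    exact ⟨⟨h1, h2, h3⟩, h4, h5, h6⟩
  · rintro ⟨⟨h1, h2, h3⟩, h4, h5, h6⟩
    exact ⟨h1, h2, h3, h4, h5, h6⟩

end Sets

end MultiGraph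

end PercRepro
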